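import Summits.AtomisticToContinuum.Crystallization.Theorems.FrustratedLawDichotomyCollarNonExemptCoords

/-!
# FrustratedLawDichotomy · crux `AperiodicFrustratedLawGap` (stmt-AtomisticToContinuum-27623) — ANISOTROPIC and TWO-ZONE closed-form move
# certificates for the exemption of record (decomp-a2c, prover hand 2, generation 17; critic rows 590 (3) / 592 (3): the isotropic certificate
# `…CollarNonExempt.not_moveUnstableCore_of_bregmanCert_closed` bounds the one-atom gain by `φ_F²/(4L)` with `L = λ_min(A) − βs + C₄⁻s²` and so
# cannot decide FORCE-BEARING cells such as `cellT3` / `TEQ65` (`|F| ≈ 0.19–0.225`, needing `L ≥ 13.5–19 > λ ≈ 9–13`); the two sharper closed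
# forms below use the same rational data and still NO branch-and-bound)

With site `j`, local set `K = {k ≠ j : dist y_k y_j ≤ Rm}`, `w_k = y_j − y_k`, `Q_k = ‖w_k‖²`, `Ṽ'(Q) = −Q⁻⁷/2 + Q⁻⁴/2`, net force `F = Σ 2Ṽ'(Q_k) w_k`,
`S = Σ Ṽ'(Q_k)`, `B = Σ 4c_k w_k`, a move `d` (`‖d‖ ≤ s`) changes the local energy by at least the QUARTIC MODEL

  `model(d) = ⟪F, d⟫ + S‖d‖² + 4 Σ c_k ⟪w_k, d⟫² + ‖d‖²⟪B, d⟫ + ‖d‖⁴ Σ c_k`     (§1 `moveEnergy_sub_ge_model`, per-bond Bregman constants `c_k`).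

* §1 the model as pure algebra over an arbitrary finset (`model`-free statements: everything is spelled out), its ISOTROPIC minorant
  `−φ_F ρ + λρ² − βρ³ + C₄ρ⁴` and ★ its ANISOTROPIC minorant on the ball `‖d‖ ≤ s`:
  `model(d) ≥ ⟪F, d⟫ + (S − βs + C₄⁻s²)‖d‖² + 4 Σ c_k ⟪w_k, d⟫²` (`C₄⁻ ≤ min(Σ c_k, 0)`), i.e. the FULL quadratic form is kept;
* §2 ★★ `not_moveUnstableCore_of_bregmanCert_aniso` — the move test from the anisotropic certificate
  `∀ ‖d‖ ≤ s, 0 ≤ ⟪F, d⟫ + (S − βs + C₄⁻s² + μ)‖d‖² + 4 Σ c_k ⟪w_k, d⟫² + (ε + slack − μ s²)` (`μ ≥ 0` = the S-procedure multiplier of the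
  ball constraint; `μ = 0` and `λ I ≤` the quadratic form recover the isotropic certificate, whose gain bound `φ_F²/(4L)` becomes `¼ Fᵀ M⁻¹ F`,
  `M = (S − βs + C₄⁻s² + μ)I + 4 Σ c_k w_k w_kᵀ`);
* §3 ★ the certificate in CHECKER FORM: a 4×4 `LDLᵀ` lemma `quadForm4_ge_of_ldl` and `anisoCert_of_ldl4` producing the §2 hypothesis from a
  lower bound `S_lo ≤ S`, coordinate enclosures `|F_a − f_a| ≤ τ` of the force, the six exact entry sums `4 Σ c_k w_k a w_k b`, and ONE `LDLᵀ`
  factorisation with `D ≥ 0` of the bordered matrix `[[M̃, f/2], [fᵀ/2, ε + slack − μs² − 3τs]]` — finitely many rational identities/inequalities;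
* (sibling `…CollarNonExemptTwoZone`) the TWO-ZONE certificate: inner ball anisotropic with tighter-range Bregman constants, outer shell isotropic.
All `[folklore]` (elementary real algebra); 0 sorry; no definitions.
-/

noncomputable section

namespace Summit.AtomisticToContinuum.Crystallization.Theorems.FrustratedLawDichotomyCollarNonExemptAniso

open scoped BigOperators Classical RealInnerProductSpace
open Literature.MathematicalPhysics.StatisticalMechanics (lennardJones)
open Literature.Algebra.EuclideanLattices (inner_fin_three norm_sq_fin_three)
open Summit.AtomisticToContinuum.Crystallization.Theorems.FrustratedLawDichotomyExemptAbsorptionRecord (MoveUnstableCore)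
open Summit.AtomisticToContinuum.Crystallization.Theorems.FrustratedLawDichotomyCollarNonExempt
  (lennardJones_dist_eq_sq sq_dist_move quartic_ge_of_closed)
open Summit.AtomisticToContinuum.Crystallization.Theorems.FrustratedLawDichotomyCollarNonExemptCoords
  (sum_smul_apply sum_mul_inner_sq_eq_coords)

/-! ## §1. The quartic model: derivation and its two minorants -/

/-- The move test follows from a uniform lower bound `−(ε + slack)` on the local energy change of every admissible move (definition unfolding).
[folklore] -/
theorem not_moveUnstableCore_of_forall {ε Rm s : ℝ} {N : ℕ} {y : Fin N → EuclideanSpace ℝ (Fin 3)} {j : Fin N}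
    (h : ∀ p : EuclideanSpace ℝ (Fin 3), dist p (y j) ≤ s →
      -(ε + s * (Rm / (Rm - s)) ^ 7 * (6000 / 343 * Rm⁻¹ ^ 4 + 2880 / 49 * Rm⁻¹ ^ 5 + 10 / 7 * Rm⁻¹ ^ 6 + 2 * Rm⁻¹ ^ 7)) ≤
        (∑ k ∈ (Finset.univ.erase j).filter (fun k => dist (y k) (y j) ≤ Rm), lennardJones (dist p (y k))) -
          ∑ k ∈ (Finset.univ.erase j).filter (fun k => dist (y k) (y j) ≤ Rm), lennardJones (dist (y j) (y k))) :
    ¬ MoveUnstableCore ε Rm s N y j := by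
  unfold MoveUnstableCore
  rintro ⟨p, hps, -, hlt⟩
  have := h p hps
  linarith

/-- ★ **THE QUARTIC MODEL** (`moveEnergy_sub_ge_model`): under the range hypothesis `hrange` (for moves of length `≤ s'`) and per-bond Bregman
constants `hbreg`, every move `p` with `dist p y_j ≤ s'`, `d = p − y_j`, satisfies
`Σ_K V(dist p y_k) − Σ_K V(dist y_j y_k) ≥ ⟪F, d⟫ + S‖d‖² + 4 Σ c_k ⟪w_k, d⟫² + ‖d‖²⟪B, d⟫ + ‖d‖⁴ Σ c_k`. [folklore] -/
theorem moveEnergy_sub_ge_model {Rm s' : ℝ} {N : ℕ} {y : Fin N → EuclideanSpace ℝ (Fin 3)} {j : Fin N} (c Plo Phi : Fin N → ℝ)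
    (hrange : ∀ k ∈ (Finset.univ.erase j).filter (fun k => dist (y k) (y j) ≤ Rm), ∀ p : EuclideanSpace ℝ (Fin 3),
      dist p (y j) ≤ s' → Plo k ≤ dist p (y k) ^ 2 ∧ dist p (y k) ^ 2 ≤ Phi k)
    (hbreg : ∀ k ∈ (Finset.univ.erase j).filter (fun k => dist (y k) (y j) ≤ Rm), ∀ P : ℝ, Plo k ≤ P → P ≤ Phi k →
      c k * (P - dist (y j) (y k) ^ 2) ^ 2 ≤
        ((1 / 12) * P⁻¹ ^ 6 - (1 / 6) * P⁻¹ ^ 3) - ((1 / 12) * (dist (y j) (y k) ^ 2)⁻¹ ^ 6 - (1 / 6) * (dist (y j) (y k) ^ 2)⁻¹ ^ 3) -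
          (-(1 / 2) * (dist (y j) (y k) ^ 2)⁻¹ ^ 7 + (1 / 2) * (dist (y j) (y k) ^ 2)⁻¹ ^ 4) * (P - dist (y j) (y k) ^ 2))
    (p : EuclideanSpace ℝ (Fin 3)) (hp : dist p (y j) ≤ s') :
    ⟪∑ k ∈ (Finset.univ.erase j).filter (fun k => dist (y k) (y j) ≤ Rm),
        (2 * (-(1 / 2) * (dist (y j) (y k) ^ 2)⁻¹ ^ 7 + (1 / 2) * (dist (y j) (y k) ^ 2)⁻¹ ^ 4)) • (y j - y k), p - y j⟫ +
      (∑ k ∈ (Finset.univ.erase j).filter (fun k => dist (y k) (y j) ≤ Rm),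
        (-(1 / 2) * (dist (y j) (y k) ^ 2)⁻¹ ^ 7 + (1 / 2) * (dist (y j) (y k) ^ 2)⁻¹ ^ 4)) * ‖p - y j‖ ^ 2 +
      4 * (∑ k ∈ (Finset.univ.erase j).filter (fun k => dist (y k) (y j) ≤ Rm), c k * ⟪y j - y k, p - y j⟫ ^ 2) +
      ‖p - y j‖ ^ 2 * ⟪∑ k ∈ (Finset.univ.erase j).filter (fun k => dist (y k) (y j) ≤ Rm), (4 * c k) • (y j - y k), p - y j⟫ +
      ‖p - y j‖ ^ 4 * ∑ k ∈ (Finset.univ.erase j).filter (fun k => dist (y k) (y j) ≤ Rm), c k ≤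
    (∑ k ∈ (Finset.univ.erase j).filter (fun k => dist (y k) (y j) ≤ Rm), lennardJones (dist p (y k))) -
      ∑ k ∈ (Finset.univ.erase j).filter (fun k => dist (y k) (y j) ≤ Rm), lennardJones (dist (y j) (y k)) := by
  set K := (Finset.univ.erase j).filter (fun k => dist (y k) (y j) ≤ Rm) with hK
  set d : EuclideanSpace ℝ (Fin 3) := p - y j with hd
  set Q : Fin N → ℝ := fun k => dist (y j) (y k) ^ 2 with hQ
  set dV : Fin N → ℝ := fun k => -(1 / 2) * (Q k)⁻¹ ^ 7 + (1 / 2) * (Q k)⁻¹ ^ 4 with hdV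
  set Pk : Fin N → ℝ := fun k => dist p (y k) ^ 2 with hPk
  have hP : ∀ k, Pk k = Q k + 2 * ⟪y j - y k, d⟫ + ‖d‖ ^ 2 := fun k => by
    simp only [hPk, hQ, hd]; exact sq_dist_move p (y j) (y k)
  have hbond : ∀ k ∈ K, dV k * (2 * ⟪y j - y k, d⟫ + ‖d‖ ^ 2) + c k * (2 * ⟪y j - y k, d⟫ + ‖d‖ ^ 2) ^ 2 ≤
      lennardJones (dist p (y k)) - lennardJones (dist (y j) (y k)) := by
    intro k hk
    have hr := hrange k hk p hp
    have hb := hbreg k hk (Pk k) hr.1 hr.2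
    rw [lennardJones_dist_eq_sq, lennardJones_dist_eq_sq]
    have e : Pk k - Q k = 2 * ⟪y j - y k, d⟫ + ‖d‖ ^ 2 := by rw [hP k]; ring
    rw [← e]
    simp only [hPk, hQ, hdV] at hb ⊢
    linarith
  have hsum := Finset.sum_le_sum hbond
  rw [Finset.sum_add_distrib, Finset.sum_sub_distrib] at hsum
  have hlin : ∑ k ∈ K, dV k * (2 * ⟪y j - y k, d⟫ + ‖d‖ ^ 2) =
      ⟪∑ k ∈ K, (2 * dV k) • (y j - y k), d⟫ + (∑ k ∈ K, dV k) * ‖d‖ ^ 2 := by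
    rw [sum_inner, Finset.sum_mul, ← Finset.sum_add_distrib]
    refine Finset.sum_congr rfl fun k _ => ?_
    rw [real_inner_smul_left]; ring
  have hquad : ∑ k ∈ K, c k * (2 * ⟪y j - y k, d⟫ + ‖d‖ ^ 2) ^ 2 =
      4 * ∑ k ∈ K, c k * ⟪y j - y k, d⟫ ^ 2 + ‖d‖ ^ 2 * ⟪∑ k ∈ K, (4 * c k) • (y j - y k), d⟫ + ‖d‖ ^ 4 * ∑ k ∈ K, c k := by
    rw [sum_inner, Finset.mul_sum, Finset.mul_sum, Finset.mul_sum, ← Finset.sum_add_distrib, ← Finset.sum_add_distrib]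
    refine Finset.sum_congr rfl fun k _ => ?_
    rw [real_inner_smul_left]; ring
  rw [hlin, hquad] at hsum
  simp only [hdV, hQ] at hsum
  linarith

/-- ★ **ANISOTROPIC MINORANT of the model on the ball** (pure algebra over any finset): with `β ≥ ‖B‖`, `C₄⁻ ≤ Σ c_k`, `C₄⁻ ≤ 0` and `‖d‖ ≤ s`,
`⟪F,d⟫ + S‖d‖² + 4Σ c_k⟪w_k,d⟫² + ‖d‖²⟪B,d⟫ + ‖d‖⁴ Σ c_k ≥ ⟪F,d⟫ + (S − βs + C₄⁻s²)‖d‖² + 4Σ c_k⟪w_k,d⟫²`. [folklore] -/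
theorem model_ge_aniso {ι : Type*} (K : Finset ι) (c : ι → ℝ) (w : ι → EuclideanSpace ℝ (Fin 3)) (F B d : EuclideanSpace ℝ (Fin 3))
    {S beta C4m s : ℝ} (hB : ‖B‖ ≤ beta) (hC4 : C4m ≤ ∑ k ∈ K, c k) (hC4m : C4m ≤ 0) (hd : ‖d‖ ≤ s) :
    ⟪F, d⟫ + (S - beta * s + C4m * s ^ 2) * ‖d‖ ^ 2 + 4 * ∑ k ∈ K, c k * ⟪w k, d⟫ ^ 2 ≤
      ⟪F, d⟫ + S * ‖d‖ ^ 2 + 4 * (∑ k ∈ K, c k * ⟪w k, d⟫ ^ 2) + ‖d‖ ^ 2 * ⟪B, d⟫ + ‖d‖ ^ 4 * ∑ k ∈ K, c k := by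
  have hρ0 : 0 ≤ ‖d‖ := norm_nonneg _
  have hρ2 : ‖d‖ ^ 2 ≤ s ^ 2 := pow_le_pow_left₀ hρ0 hd 2
  -- the cubic term
  have h2 : -(beta * ‖d‖) ≤ ⟪B, d⟫ := by
    have := abs_real_inner_le_norm B d
    have hle := mul_le_mul_of_nonneg_right hB hρ0
    have := neg_abs_le ⟪B, d⟫
    linarith
  have h2' : -(beta * s) * ‖d‖ ^ 2 ≤ ‖d‖ ^ 2 * ⟪B, d⟫ := by
    have hbs : beta * ‖d‖ ≤ beta * s := by
      have hb0 : 0 ≤ beta := (norm_nonneg _).trans hB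
      exact mul_le_mul_of_nonneg_left hd hb0
    have := mul_le_mul_of_nonneg_left h2 (sq_nonneg ‖d‖)
    nlinarith [sq_nonneg ‖d‖]
  -- the quartic term
  have h4 : C4m * s ^ 2 * ‖d‖ ^ 2 ≤ ‖d‖ ^ 4 * ∑ k ∈ K, c k := by
    have a1 : C4m * s ^ 2 ≤ C4m * ‖d‖ ^ 2 := mul_le_mul_of_nonpos_left hρ2 hC4m
    have a2 : C4m * ‖d‖ ^ 2 * ‖d‖ ^ 2 ≤ (∑ k ∈ K, c k) * ‖d‖ ^ 2 * ‖d‖ ^ 2 :=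
      mul_le_mul_of_nonneg_right (mul_le_mul_of_nonneg_right hC4 (sq_nonneg _)) (sq_nonneg _)
    have a3 := mul_le_mul_of_nonneg_right a1 (sq_nonneg ‖d‖)
    nlinarith
  nlinarith

/-- ★ **ISOTROPIC MINORANT of the model** (pure algebra): with `φ_F ≥ ‖F‖`, `β ≥ ‖B‖`, `C₄ ≤ Σ c_k` and `λ‖v‖² ≤ S‖v‖² + 4Σ c_k⟪w_k,v⟫²` for all `v`,
`model(d) ≥ −φ_F‖d‖ + λ‖d‖² − β‖d‖³ + C₄‖d‖⁴`. [folklore] -/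
theorem model_ge_iso {ι : Type*} (K : Finset ι) (c : ι → ℝ) (w : ι → EuclideanSpace ℝ (Fin 3)) (F B d : EuclideanSpace ℝ (Fin 3))
    {S lam beta phiF C4 : ℝ} (hA : ∀ v : EuclideanSpace ℝ (Fin 3), lam * ‖v‖ ^ 2 ≤ S * ‖v‖ ^ 2 + 4 * ∑ k ∈ K, c k * ⟪w k, v⟫ ^ 2)
    (hB : ‖B‖ ≤ beta) (hF : ‖F‖ ≤ phiF) (hC4 : C4 ≤ ∑ k ∈ K, c k) :
    -phiF * ‖d‖ + lam * ‖d‖ ^ 2 - beta * ‖d‖ ^ 3 + C4 * ‖d‖ ^ 4 ≤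
      ⟪F, d⟫ + S * ‖d‖ ^ 2 + 4 * (∑ k ∈ K, c k * ⟪w k, d⟫ ^ 2) + ‖d‖ ^ 2 * ⟪B, d⟫ + ‖d‖ ^ 4 * ∑ k ∈ K, c k := by
  have hρ0 : 0 ≤ ‖d‖ := norm_nonneg _
  have h1 : -(phiF * ‖d‖) ≤ ⟪F, d⟫ := by
    have := abs_real_inner_le_norm F d
    have hle := mul_le_mul_of_nonneg_right hF hρ0
    have := neg_abs_le ⟪F, d⟫
    linarith
  have h2 : -(beta * ‖d‖) ≤ ⟪B, d⟫ := by
    have := abs_real_inner_le_norm B d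
    have hle := mul_le_mul_of_nonneg_right hB hρ0
    have := neg_abs_le ⟪B, d⟫
    linarith
  have h3 := hA d
  have h4 : C4 * ‖d‖ ^ 4 ≤ ‖d‖ ^ 4 * ∑ k ∈ K, c k := by
    rw [mul_comm]; exact mul_le_mul_of_nonneg_left hC4 (by positivity)
  have h2' : -(beta * ‖d‖ ^ 3) ≤ ‖d‖ ^ 2 * ⟪B, d⟫ := by
    have := mul_le_mul_of_nonneg_left h2 (sq_nonneg ‖d‖)
    nlinarith
  linarith

/-! ## §2. The move test from an anisotropic certificate -/

/-- ★★ **THE MOVE TEST FROM AN ANISOTROPIC CERTIFICATE** (`not_moveUnstableCore_of_bregmanCert_aniso`).  Data as in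
`…CollarNonExempt.not_moveUnstableCore_of_bregmanCert` (`hrange`, `hbreg`, `hB : ‖Σ 4c_k w_k‖ ≤ β`), a nonpositive lower bound `C₄⁻ ≤ Σ c_k`, an
S-procedure multiplier `μ ≥ 0`, and the anisotropic quadratic certificate on the ball
`hN : ∀ ‖d‖ ≤ s, 0 ≤ ⟪F, d⟫ + (S − βs + C₄⁻s² + μ)‖d‖² + 4 Σ c_k ⟪w_k, d⟫² + (ε + slack − μs²)`
(`F = Σ 2Ṽ'(Q_k) w_k`, `S = Σ Ṽ'(Q_k)`, `w_k = y_j − y_k`).  CONCLUSION: the site passes the move test. [folklore] -/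
theorem not_moveUnstableCore_of_bregmanCert_aniso {ε Rm s : ℝ} {N : ℕ} {y : Fin N → EuclideanSpace ℝ (Fin 3)} {j : Fin N}
    (c Plo Phi : Fin N → ℝ) (beta C4m mu : ℝ) (hC4m : C4m ≤ 0) (hmu : 0 ≤ mu)
    (hrange : ∀ k ∈ (Finset.univ.erase j).filter (fun k => dist (y k) (y j) ≤ Rm), ∀ p : EuclideanSpace ℝ (Fin 3),
      dist p (y j) ≤ s → Plo k ≤ dist p (y k) ^ 2 ∧ dist p (y k) ^ 2 ≤ Phi k)
    (hbreg : ∀ k ∈ (Finset.univ.erase j).filter (fun k => dist (y k) (y j) ≤ Rm), ∀ P : ℝ, Plo k ≤ P → P ≤ Phi k →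
      c k * (P - dist (y j) (y k) ^ 2) ^ 2 ≤
        ((1 / 12) * P⁻¹ ^ 6 - (1 / 6) * P⁻¹ ^ 3) - ((1 / 12) * (dist (y j) (y k) ^ 2)⁻¹ ^ 6 - (1 / 6) * (dist (y j) (y k) ^ 2)⁻¹ ^ 3) -
          (-(1 / 2) * (dist (y j) (y k) ^ 2)⁻¹ ^ 7 + (1 / 2) * (dist (y j) (y k) ^ 2)⁻¹ ^ 4) * (P - dist (y j) (y k) ^ 2))
    (hB : ‖∑ k ∈ (Finset.univ.erase j).filter (fun k => dist (y k) (y j) ≤ Rm), (4 * c k) • (y j - y k)‖ ≤ beta)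
    (hC4 : C4m ≤ ∑ k ∈ (Finset.univ.erase j).filter (fun k => dist (y k) (y j) ≤ Rm), c k)
    (hN : ∀ d : EuclideanSpace ℝ (Fin 3), ‖d‖ ≤ s →
      0 ≤ ⟪∑ k ∈ (Finset.univ.erase j).filter (fun k => dist (y k) (y j) ≤ Rm),
              (2 * (-(1 / 2) * (dist (y j) (y k) ^ 2)⁻¹ ^ 7 + (1 / 2) * (dist (y j) (y k) ^ 2)⁻¹ ^ 4)) • (y j - y k), d⟫ +
            ((∑ k ∈ (Finset.univ.erase j).filter (fun k => dist (y k) (y j) ≤ Rm),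
                (-(1 / 2) * (dist (y j) (y k) ^ 2)⁻¹ ^ 7 + (1 / 2) * (dist (y j) (y k) ^ 2)⁻¹ ^ 4)) - beta * s + C4m * s ^ 2 + mu) *
              ‖d‖ ^ 2 +
            4 * (∑ k ∈ (Finset.univ.erase j).filter (fun k => dist (y k) (y j) ≤ Rm), c k * ⟪y j - y k, d⟫ ^ 2) +
            (ε + s * (Rm / (Rm - s)) ^ 7 * (6000 / 343 * Rm⁻¹ ^ 4 + 2880 / 49 * Rm⁻¹ ^ 5 + 10 / 7 * Rm⁻¹ ^ 6 + 2 * Rm⁻¹ ^ 7) -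
              mu * s ^ 2)) :
    ¬ MoveUnstableCore ε Rm s N y j := by
  refine not_moveUnstableCore_of_forall fun p hp => ?_
  set K := (Finset.univ.erase j).filter (fun k => dist (y k) (y j) ≤ Rm) with hK
  have hmodel := moveEnergy_sub_ge_model c Plo Phi hrange hbreg p hp
  have hd : ‖p - y j‖ ≤ s := by rwa [← dist_eq_norm]
  have han := model_ge_aniso K c (fun k => y j - y k)
    (∑ k ∈ K, (2 * (-(1 / 2) * (dist (y j) (y k) ^ 2)⁻¹ ^ 7 + (1 / 2) * (dist (y j) (y k) ^ 2)⁻¹ ^ 4)) • (y j - y k))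
    (∑ k ∈ K, (4 * c k) • (y j - y k)) (p - y j)
    (S := ∑ k ∈ K, (-(1 / 2) * (dist (y j) (y k) ^ 2)⁻¹ ^ 7 + (1 / 2) * (dist (y j) (y k) ^ 2)⁻¹ ^ 4)) hB hC4 hC4m hd
  have hcert := hN (p - y j) hd
  -- the S-procedure term `μ(‖d‖² − s²) ≤ 0`
  have hμ : mu * ‖p - y j‖ ^ 2 ≤ mu * s ^ 2 := mul_le_mul_of_nonneg_left (pow_le_pow_left₀ (norm_nonneg _) hd 2) hmu
  nlinarith

/-- ★ The isotropic certificate is the special case `μ = 0` with the quadratic form minorised by `λ‖d‖²`: hypothesis `hN` of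
`not_moveUnstableCore_of_bregmanCert_aniso` from `hA`, `hF` and the closed scalar condition (`L = λ − βs + C₄⁻s² > 0`, `φ_F² ≤ 4L(ε + σ)`).
[folklore] -/
theorem anisoCert_of_iso {ι : Type*} (K : Finset ι) (c : ι → ℝ) (w : ι → EuclideanSpace ℝ (Fin 3)) (F : EuclideanSpace ℝ (Fin 3))
    {S lam beta C4m phiF s γ : ℝ} (hA : ∀ v : EuclideanSpace ℝ (Fin 3), lam * ‖v‖ ^ 2 ≤ S * ‖v‖ ^ 2 + 4 * ∑ k ∈ K, c k * ⟪w k, v⟫ ^ 2)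
    (hF : ‖F‖ ≤ phiF) (hL : 0 < lam - beta * s + C4m * s ^ 2) (hcert : phiF ^ 2 ≤ 4 * (lam - beta * s + C4m * s ^ 2) * γ) :
    ∀ d : EuclideanSpace ℝ (Fin 3), ‖d‖ ≤ s →
      0 ≤ ⟪F, d⟫ + (S - beta * s + C4m * s ^ 2 + 0) * ‖d‖ ^ 2 + 4 * (∑ k ∈ K, c k * ⟪w k, d⟫ ^ 2) + (γ - 0 * s ^ 2) := by
  intro d _
  set L := lam - beta * s + C4m * s ^ 2 with hLdef
  have hρ0 : 0 ≤ ‖d‖ := norm_nonneg _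
  have h1 : -(phiF * ‖d‖) ≤ ⟪F, d⟫ := by
    have := abs_real_inner_le_norm F d
    have hle := mul_le_mul_of_nonneg_right hF hρ0
    have := neg_abs_le ⟪F, d⟫
    linarith
  have h3 := hA d
  have hsq : 0 ≤ L * (‖d‖ - phiF / (2 * L)) ^ 2 := mul_nonneg hL.le (sq_nonneg _)
  have hexp : L * (‖d‖ - phiF / (2 * L)) ^ 2 = -phiF * ‖d‖ + L * ‖d‖ ^ 2 + phiF ^ 2 / (4 * L) := by
    field_simp
    ring
  have hq : phiF ^ 2 / (4 * L) ≤ γ := by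
    rw [div_le_iff₀ (by positivity)]
    linarith
  rw [hLdef] at hexp
  nlinarith

/-! ## §3. Checker form: a 4×4 `LDLᵀ` certificate of the bordered matrix -/

/-- ★ **4×4 `LDLᵀ` certificate**: a symmetric 4×4 matrix `N = (n_ab)` with `N = L D Lᵀ`, `L` unit lower-triangular
(`l₁₀ l₂₀ l₂₁ l₃₀ l₃₁ l₃₂`), `D = diag(d₀, d₁, d₂, d₃) ≥ 0` (the ten entry identities below) is positive semidefinite:
`0 ≤ vᵀ N v` for all `v ∈ ℝ⁴`. [folklore] -/
theorem quadForm4_ge_of_ldl {n00 n01 n02 n03 n11 n12 n13 n22 n23 n33 l10 l20 l21 l30 l31 l32 d0 d1 d2 d3 : ℝ}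
    (hd0 : 0 ≤ d0) (hd1 : 0 ≤ d1) (hd2 : 0 ≤ d2) (hd3 : 0 ≤ d3)
    (h00 : n00 = d0) (h01 : n01 = l10 * d0) (h02 : n02 = l20 * d0) (h03 : n03 = l30 * d0)
    (h11 : n11 = l10 ^ 2 * d0 + d1) (h12 : n12 = l20 * l10 * d0 + l21 * d1) (h13 : n13 = l30 * l10 * d0 + l31 * d1)
    (h22 : n22 = l20 ^ 2 * d0 + l21 ^ 2 * d1 + d2) (h23 : n23 = l30 * l20 * d0 + l31 * l21 * d1 + l32 * d2)
    (h33 : n33 = l30 ^ 2 * d0 + l31 ^ 2 * d1 + l32 ^ 2 * d2 + d3) (v0 v1 v2 v3 : ℝ) :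
    0 ≤ n00 * v0 ^ 2 + n11 * v1 ^ 2 + n22 * v2 ^ 2 + n33 * v3 ^ 2 +
      2 * (n01 * v0 * v1 + n02 * v0 * v2 + n03 * v0 * v3 + n12 * v1 * v2 + n13 * v1 * v3 + n23 * v2 * v3) := by
  have key : n00 * v0 ^ 2 + n11 * v1 ^ 2 + n22 * v2 ^ 2 + n33 * v3 ^ 2 +
      2 * (n01 * v0 * v1 + n02 * v0 * v2 + n03 * v0 * v3 + n12 * v1 * v2 + n13 * v1 * v3 + n23 * v2 * v3) =
      d0 * (v0 + l10 * v1 + l20 * v2 + l30 * v3) ^ 2 + d1 * (v1 + l21 * v2 + l31 * v3) ^ 2 + d2 * (v2 + l32 * v3) ^ 2 + d3 * v3 ^ 2 := by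
    rw [h00, h01, h02, h03, h11, h12, h13, h22, h23, h33]; ring
  rw [key]
  have h1 : 0 ≤ d0 * (v0 + l10 * v1 + l20 * v2 + l30 * v3) ^ 2 := mul_nonneg hd0 (sq_nonneg _)
  have h2 : 0 ≤ d1 * (v1 + l21 * v2 + l31 * v3) ^ 2 := mul_nonneg hd1 (sq_nonneg _)
  have h3 : 0 ≤ d2 * (v2 + l32 * v3) ^ 2 := mul_nonneg hd2 (sq_nonneg _)
  have h4 : 0 ≤ d3 * v3 ^ 2 := mul_nonneg hd3 (sq_nonneg _)
  linarith

/-- Coordinates of an inner product against a weighted sum: `⟪Σ_k a_k • w_k, d⟫ = Σ_a (Σ_k a_k w_k a) d_a`. [folklore] -/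
theorem inner_sum_smul_eq_coords {N : ℕ} (s : Finset (Fin N)) (a : Fin N → ℝ) (w : Fin N → EuclideanSpace ℝ (Fin 3))
    (d : EuclideanSpace ℝ (Fin 3)) :
    ⟪∑ k ∈ s, a k • w k, d⟫ = (∑ k ∈ s, a k * w k 0) * d 0 + (∑ k ∈ s, a k * w k 1) * d 1 + (∑ k ∈ s, a k * w k 2) * d 2 := by
  rw [inner_fin_three, sum_smul_apply, sum_smul_apply, sum_smul_apply]

/-- A coordinate is bounded by the norm: `|d_a| ≤ ‖d‖`. [folklore] -/
theorem abs_apply_le_norm (d : EuclideanSpace ℝ (Fin 3)) (a : Fin 3) : |d a| ≤ ‖d‖ := by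
  simpa [Real.norm_eq_abs] using PiLp.norm_apply_le d a

/-- ★★ **THE ANISOTROPIC CERTIFICATE IN CHECKER FORM** (`anisoCert_of_ldl4`).  Rational data: a lower bound `S_lo ≤ S = Σ_K Ṽ'(Q_k)` (`hS`),
force coordinates `f a` with enclosures `|Σ_K 2Ṽ'(Q_k) w_k a − f a| ≤ τ` (`hFa`, `τ ≥ 0`), the six EXACT entry sums `4 Σ_K c_k w_k a w_k b`, the
literals `β, C₄⁻, μ, s, γ` (`γ` = `ε + slack`), and ONE 4×4 `LDLᵀ` factorisation with `D ≥ 0` of the bordered matrix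
`[[T·I + 4Σ c_k w_k w_kᵀ, f/2], [fᵀ/2, γ − μs² − 3τs]]`, `T = S_lo − βs + C₄⁻s² + μ` (the ten identities `h00 … h33`).  CONCLUSION: the hypothesis
`hN` of `not_moveUnstableCore_of_bregmanCert_aniso` (with the true `S` and the true force). [folklore] -/
theorem anisoCert_of_ldl4 {N : ℕ} (K : Finset (Fin N)) (c dV : Fin N → ℝ) (w : Fin N → EuclideanSpace ℝ (Fin 3)) (f : Fin 3 → ℝ)
    {Slo beta C4m mu s γ τ l10 l20 l21 l30 l31 l32 d0 d1 d2 d3 : ℝ} (hτ : 0 ≤ τ)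
    (hS : Slo ≤ ∑ k ∈ K, dV k) (hFa : ∀ a : Fin 3, |(∑ k ∈ K, 2 * dV k * w k a) - f a| ≤ τ)
    (hd0 : 0 ≤ d0) (hd1 : 0 ≤ d1) (hd2 : 0 ≤ d2) (hd3 : 0 ≤ d3)
    (h00 : Slo - beta * s + C4m * s ^ 2 + mu + 4 * (∑ k ∈ K, c k * w k 0 ^ 2) = d0)
    (h01 : 4 * (∑ k ∈ K, c k * (w k 0 * w k 1)) = l10 * d0)
    (h02 : 4 * (∑ k ∈ K, c k * (w k 0 * w k 2)) = l20 * d0)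
    (h03 : f 0 / 2 = l30 * d0)
    (h11 : Slo - beta * s + C4m * s ^ 2 + mu + 4 * (∑ k ∈ K, c k * w k 1 ^ 2) = l10 ^ 2 * d0 + d1)
    (h12 : 4 * (∑ k ∈ K, c k * (w k 1 * w k 2)) = l20 * l10 * d0 + l21 * d1)
    (h13 : f 1 / 2 = l30 * l10 * d0 + l31 * d1)
    (h22 : Slo - beta * s + C4m * s ^ 2 + mu + 4 * (∑ k ∈ K, c k * w k 2 ^ 2) = l20 ^ 2 * d0 + l21 ^ 2 * d1 + d2)
    (h23 : f 2 / 2 = l30 * l20 * d0 + l31 * l21 * d1 + l32 * d2)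
    (h33 : γ - mu * s ^ 2 - 3 * τ * s = l30 ^ 2 * d0 + l31 ^ 2 * d1 + l32 ^ 2 * d2 + d3) :
    ∀ d : EuclideanSpace ℝ (Fin 3), ‖d‖ ≤ s →
      0 ≤ ⟪∑ k ∈ K, (2 * dV k) • w k, d⟫ + ((∑ k ∈ K, dV k) - beta * s + C4m * s ^ 2 + mu) * ‖d‖ ^ 2 +
        4 * (∑ k ∈ K, c k * ⟪w k, d⟫ ^ 2) + (γ - mu * s ^ 2) := by
  intro d hd
  have hq := quadForm4_ge_of_ldl hd0 hd1 hd2 hd3 h00 h01 h02 h03 h11 h12 h13 h22 h23 h33 (d 0) (d 1) (d 2) 1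
  -- coordinates of the force term, with the enclosure
  have hF : (f 0 * d 0 + f 1 * d 1 + f 2 * d 2) - 3 * τ * s ≤ ⟪∑ k ∈ K, (2 * dV k) • w k, d⟫ := by
    rw [inner_sum_smul_eq_coords]
    have e : ∀ a : Fin 3, (∑ k ∈ K, (2 * dV k) * w k a) = ∑ k ∈ K, 2 * dV k * w k a := fun a => rfl
    have hb : ∀ a : Fin 3, f a * d a - τ * s ≤ (∑ k ∈ K, 2 * dV k * w k a) * d a := by
      intro a
      have h1 := hFa a
      have h2 := abs_apply_le_norm d a
      have h3 : |((∑ k ∈ K, 2 * dV k * w k a) - f a) * d a| ≤ τ * s := by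
        rw [abs_mul]; exact mul_le_mul h1 (h2.trans hd) (abs_nonneg _) hτ
      have h4 := neg_abs_le (((∑ k ∈ K, 2 * dV k * w k a) - f a) * d a)
      nlinarith
    have hb0 := hb 0
    have hb1 := hb 1
    have hb2 := hb 2
    rw [e 0, e 1, e 2]
    linarith
  -- the `S` term
  have hS' : (Slo - beta * s + C4m * s ^ 2 + mu) * ‖d‖ ^ 2 ≤ ((∑ k ∈ K, dV k) - beta * s + C4m * s ^ 2 + mu) * ‖d‖ ^ 2 :=
    mul_le_mul_of_nonneg_right (by linarith) (sq_nonneg _)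
  have e1 : ‖d‖ ^ 2 = d 0 ^ 2 + d 1 ^ 2 + d 2 ^ 2 := norm_sq_fin_three d
  rw [e1] at hS'
  rw [e1, sum_mul_inner_sq_eq_coords]
  linarith [hq, hF, hS']

end Summit.AtomisticToContinuum.Crystallization.Theorems.FrustratedLawDichotomyCollarNonExemptAniso

end
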